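import Mathlib
import Literature.NumberTheory.Sieve.Maynard2016SystemCRT
import Literature.NumberTheory.Sieve.Maynard2016LocalSystem
import HarnessLib

/-!
# Maynard 2016: the λ-system has at most one solution modulo `[d₁, e₁, …, d_k, e_k]`

Topic `Literature/NumberTheory/Sieve`. J. Maynard, *Large gaps between primes*, Ann. of Math. (2)
183 (2016), 915–933 = arXiv:1408.5110, §6 displays (6.7)–(6.8): in the expansion of `α_{m,q}⁻¹`
the divisibility conditions `d_j ∣ n + h_j q`, `e_j ∣ m(n + h_j q) − 1` (`j ≤ k`) are combined "by
the Chinese remainder theorem" into residue classes modulo `P_w [d, d', e, e']`; the moduli `d_j`,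
`e_i` need not be pairwise coprime (the source records the compatibility conditions
`(d_i d_i', e_j e_j') ∣ m q (h_j − h_i) − 1`), but in every case the system determines `n` modulo the
least common multiple, so it has at most one solution there (exactly one under compatibility; the
pairwise-coprime case is `Maynard2016ClassSystemCount`).

PROVED here (no named facts): `coprime_of_dvd_mul_sub_one'` (`b ∣ m t − 1 ⇒ (m, b) = 1`),
`modEq_of_localSystem` (two solutions of one local system agree mod `a` and mod `b`),
`periodic_of_dvd`, `periodic_and`, `periodic_system_lcm` (the system is `L`-periodic,
`L = lcm_j [a_j, b_j]`), `card_filter_range_system_le_one` (at most one solution mod `L`) and the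
class count `abs_card_class_lcm_system_sub_le` (`|# − N r/(P L)| ≤ 1`, `r ≤ 1` the number of
solutions), from `Maynard2016ClassCRT.abs_card_class_and_sub_le`.

## References

* J. Maynard, *Large gaps between primes*, Ann. of Math. (2) 183 (2016), 915–933; arXiv:1408.5110,
  §6 (6.7)–(6.8), (6.24)–(6.25). [Maynard2016LargeGaps]
-/

open Filter Finset
open scoped Topology

namespace Literature.NumberTheory.Sieve

namespace Maynard2016

/-- `b ∣ m t − 1` with `m t ≥ 1` forces `(m, b) = 1`. [cite: Maynard2016LargeGaps, §6 display (6.8)] -/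
theorem coprime_of_dvd_mul_sub_one' {b m t : ℕ} (h : b ∣ m * t - 1) (ht : 1 ≤ m * t) :
    Nat.Coprime m b :=
  Nat.coprime_of_mul_modEq_one t ((Nat.modEq_iff_dvd' ht).2 h).symm

/-- Two solutions of the local system `a ∣ n + c`, `b ∣ m(n + c) − 1` (`m, c ≥ 1`) agree modulo `a`
and modulo `b`. [cite: Maynard2016LargeGaps, §6 display (6.8)] -/
theorem modEq_of_localSystem {a b c m n n' : ℕ} (hm : 1 ≤ m) (hc : 1 ≤ c)
    (h₁ : a ∣ n + c ∧ b ∣ m * (n + c) - 1) (h₂ : a ∣ n' + c ∧ b ∣ m * (n' + c) - 1) :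
    n ≡ n' [MOD a] ∧ n ≡ n' [MOD b] := by
  refine ⟨?_, ?_⟩
  · have e₁ : n + c ≡ 0 [MOD a] := Nat.modEq_zero_iff_dvd.2 h₁.1
    have e₂ : n' + c ≡ 0 [MOD a] := Nat.modEq_zero_iff_dvd.2 h₂.1
    exact Nat.ModEq.add_right_cancel' c (e₁.trans e₂.symm)
  · have ht₁ : 1 ≤ m * (n + c) := Nat.mul_pos hm (by omega)
    have ht₂ : 1 ≤ m * (n' + c) := Nat.mul_pos hm (by omega)
    have e₁ : 1 ≡ m * (n + c) [MOD b] := (Nat.modEq_iff_dvd' ht₁).2 h₁.2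
    have e₂ : 1 ≡ m * (n' + c) [MOD b] := (Nat.modEq_iff_dvd' ht₂).2 h₂.2
    have hcop : Nat.Coprime m b := coprime_of_dvd_mul_sub_one' h₁.2 ht₁
    have e : m * (n + c) ≡ m * (n' + c) [MOD b] := e₁.symm.trans e₂
    exact Nat.ModEq.add_right_cancel' c
      (Nat.ModEq.cancel_left_of_coprime (Nat.coprime_comm.1 hcop) e)

/-- A `d`-periodic condition is `t`-periodic for every multiple `t` of `d`. [cite: Maynard2016LargeGaps, §6 display (6.8)] -/
theorem periodic_of_dvd {R : ℕ → Prop} {d t : ℕ} (h : Function.Periodic R d) (hdt : d ∣ t) :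
    Function.Periodic R t := by
  obtain ⟨u, rfl⟩ := hdt
  intro n
  have := h.nsmul u n
  rwa [smul_eq_mul, mul_comm u d] at this

/-- A conjunction of two `t`-periodic conditions is `t`-periodic. [cite: Maynard2016LargeGaps, §6 display (6.8)] -/
theorem periodic_and {R S : ℕ → Prop} {t : ℕ} (hR : Function.Periodic R t)
    (hS : Function.Periodic S t) : Function.Periodic (fun n => R n ∧ S n) t := by
  intro n
  rw [eq_iff_iff]
  exact Iff.and (Iff.of_eq (hR n)) (Iff.of_eq (hS n))

/-- The λ-system is periodic modulo `L = lcm_j [a_j, b_j]`. [cite: Maynard2016LargeGaps, §6 displays (6.7)–(6.8)] -/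
theorem periodic_system_lcm {k : ℕ} (a b c : Fin k → ℕ) (m : ℕ) (hc : ∀ j, 1 ≤ c j) :
    Function.Periodic
      (fun n => ∀ j ∈ (Finset.univ : Finset (Fin k)), a j ∣ n + c j ∧ b j ∣ m * (n + c j) - 1)
      (Finset.univ.lcm fun j => Nat.lcm (a j) (b j)) :=
  periodic_forall_of_dvd Finset.univ (fun j => Nat.lcm (a j) (b j))
    (fun j n => a j ∣ n + c j ∧ b j ∣ m * (n + c j) - 1)
    (fun j _ => periodic_and
      (periodic_of_dvd (periodic_dvd_add (a j) (c j)) (Nat.dvd_lcm_left _ _))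
      (periodic_of_dvd (periodic_dvd_mul_add_sub_one (b j) m (hc j)) (Nat.dvd_lcm_right _ _)))
    (fun _ hj => Finset.dvd_lcm hj)

/-- **At most one solution modulo the lcm.** (`m ≥ 1`, `c_j ≥ 1`; no coprimality needed.) [cite: Maynard2016LargeGaps, §6 displays (6.7)–(6.8) («by the Chinese remainder theorem»)] -/
theorem card_filter_range_system_le_one {k : ℕ} (a b c : Fin k → ℕ) {m : ℕ} (hm : 1 ≤ m)
    (hc : ∀ j, 1 ≤ c j) :
    ((Finset.range (Finset.univ.lcm fun j => Nat.lcm (a j) (b j))).filter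
        (fun n => ∀ j ∈ (Finset.univ : Finset (Fin k)),
          a j ∣ n + c j ∧ b j ∣ m * (n + c j) - 1)).card ≤ 1 := by
  refine Finset.card_le_one.2 fun n hn n' hn' => ?_
  rw [Finset.mem_filter, Finset.mem_range] at hn hn'
  have hmod : n ≡ n' [MOD Finset.univ.lcm fun j => Nat.lcm (a j) (b j)] := by
    rw [Nat.modEq_iff_dvd]
    have hnat : (Finset.univ.lcm fun j => Nat.lcm (a j) (b j)) ∣ Int.natAbs ((n' : ℤ) - n) := by
      refine Finset.lcm_dvd fun j _ => Nat.lcm_dvd ?_ ?_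
      · have e := (modEq_of_localSystem hm (hc j) (hn.2 j (Finset.mem_univ j))
          (hn'.2 j (Finset.mem_univ j))).1
        exact Int.natCast_dvd_natCast.1 (Int.dvd_natAbs.2 (Nat.modEq_iff_dvd.1 e))
      · have e := (modEq_of_localSystem hm (hc j) (hn.2 j (Finset.mem_univ j))
          (hn'.2 j (Finset.mem_univ j))).2
        exact Int.natCast_dvd_natCast.1 (Int.dvd_natAbs.2 (Nat.modEq_iff_dvd.1 e))
    exact Int.dvd_natAbs.1 (Int.natCast_dvd_natCast.2 hnat)
  exact Nat.ModEq.eq_of_lt_of_lt hmod hn.1 hn'.1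

/-- **The class count for the λ-system, general moduli.** With `L = lcm_j [a_j, b_j] ≥ 1` coprime to
`P`, `α < P`, `m, c_j ≥ 1` and `r ≤ 1` the number of solutions of the system modulo `L`:
`| #{1 ≤ n ≤ N : n ≡ α (mod P), system} − N r/(P L) | ≤ 1`. [cite: Maynard2016LargeGaps, §6 displays (6.7)–(6.8), (6.24)–(6.25)] -/
theorem abs_card_class_lcm_system_sub_le {k P α : ℕ} (hP : 0 < P) (hα : α < P)
    (a b c : Fin k → ℕ) {m : ℕ} (hm : 1 ≤ m) (hc : ∀ j, 1 ≤ c j)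
    (hL : 0 < Finset.univ.lcm fun j => Nat.lcm (a j) (b j))
    (hPL : P.Coprime (Finset.univ.lcm fun j => Nat.lcm (a j) (b j))) (N : ℕ) :
    |(((Finset.Icc 1 N).filter (fun n => n % P = α ∧
        ∀ j ∈ (Finset.univ : Finset (Fin k)), a j ∣ n + c j ∧ b j ∣ m * (n + c j) - 1)).card : ℝ) -
        (N : ℝ) * ((Finset.range (Finset.univ.lcm fun j => Nat.lcm (a j) (b j))).filter
            (fun n => ∀ j ∈ (Finset.univ : Finset (Fin k)),
              a j ∣ n + c j ∧ b j ∣ m * (n + c j) - 1)).card /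
          ((P : ℝ) * (Finset.univ.lcm fun j => Nat.lcm (a j) (b j) : ℕ))| ≤ 1 :=
  (abs_card_class_and_sub_le hP hL hPL hα _ (periodic_system_lcm a b c m hc) N).trans
    (by exact_mod_cast card_filter_range_system_le_one a b c hm hc)

end Maynard2016

end Literature.NumberTheory.Sieve
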